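import Summits.QuantumFields.YangMills.Theorems.SwapVirialDeficitSectorLaplaceTipConeSubst
import Summits.QuantumFields.YangMills.Theorems.SwapVirialDeficitSectorLaplaceTipPXTransverse
import Summits.QuantumFields.YangMills.Theorems.SwapVirialDeficitQuantitativeLaplacePlaneGaussian
import Literature.Barriers.RiemannHypothesis.DavenportHeilbronnHamburgerModular
import HarnessLib

/-!
# Route `SwapVirialDeficit` (YangMills): THE AXIAL CONE INTEGRAL OF THE ALIGNED FRAME (hCore F5b, region PX)
# (cell ym-idea-1, skeleton ➎, `stub_core_tip`, the core; free-hands support of ⟨stmt-QuantumFields-24197⟩ `SwapVirialDeficit.SwapGluedStiffness`)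

Pure analysis, no deficit.  The aligned leader `x` carries the soft Gaussian `e^{−β·2σ|x⊥|²∕(1+|x|²)}` (`σ = (1+δt²)⁻¹`, Term1 of ✓`tip_four_floor` weakened) and,
after the transverse integral (✓`lintegral_transverse_le`), a factor `Ψ(|x|²)` depending on the radius only.  The radius must become the integration variable
(it is the reference base letter `p′₁ = |x|`) — WITHOUT polar coordinates: w3 g68's cone substitution ✓`lintegral_le_cones_transfer` ∕ ✓`lintegral_cone_subst`
(`ℝ³∖0 ⊆ K₀∪K₁∪K₂`, on `K_i`: `v = x_{≠i}∕x_i`, signed radius `a = x_i√(1+|v|²)`, Jacobian `a²(1+|v|²)^{−3∕2} ≤ a²`), then the angular factor: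
on `K₀` `e^{−g·|v|²∕(1+|v|²)} ≤ e^{−(g∕3)|v|²}` (LEAD g100's ✓`lintegral_le_of_le_exp_neg_mul_sq`: `≤ 3π∕g`), on `K₁, K₂` `|x⊥|²∕|x|² ≥ 1∕3` so `e^{−g∕3} ≤ 3∕g`
times the disc area `≤ 8` (✓`volume_disc_fin_two_le`, ✓`Hamburger1921.exp_neg_le_inv`); `g(a²) = 2βσa²∕(1+a²)` and `a²·(1∕g) = (1+a²)∕(2βσ)` — the sphere-area `a²` cancels the soft `1∕a²`:
★★ `lintegral_axial_cones_le` —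
`∫⁻_{σ<|x|²} w(x)·e^{−β·2σ(x₁²+x₂²)∕(1+|x|²)}·Ψ(|x|²) dx ≤ ofReal((3π+48)∕(2βσ)) · ∫⁻_{σ<a²} (1+a²)⁻¹·Ψ(a²) da` (`a ∈ ℝ` signed; measurable `Ψ ≥ 0`).

HONEST LABEL: one analytic brick; `leaderLayer_PX∕PY`, `hLLm`, hCore, `stub_core_tip`, ⟨24197⟩ ∕ ⟨24194⟩ remain OPEN; own crux ⟨22884⟩ `LargeFieldMassRefinementTail` OPEN
(blocked-on ⟨19935⟩); the Yang–Mills mass gap is NOT proved; no summit is proved by a line.  THEOREMS ONLY (0 `def`, 0 `sorry`, no instance), standard axioms.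
Width seat ym-line-sfw-p2-w2 g61 (cell ym-idea-1, free hands), `--supports stmt-QuantumFields-24197`.  References: [folklore].
-/

set_option autoImplicit false

noncomputable section

open MeasureTheory Set
open scoped BigOperators ENNReal

namespace Summit.QuantumFields.YangMills.Theorems.SwapVirialDeficit.SectorLaplace

open Summit.QuantumFields.YangMills.Theorems.SwapVirialDeficit.BlowUpRing
open Summit.QuantumFields.YangMills.Theorems.SwapVirialDeficit.Gnomonic (normSq3 normSq3_smul normSq3_nonneg gnomonicWeight)
open Summit.QuantumFields.YangMills.Theorems.QuantitativeLaplace (lintegral_le_of_le_exp_neg_mul_sq volume_disc_fin_two_le)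
open Literature.Barriers.RiemannHypothesis.Hamburger1921 (exp_neg_le_inv)

/-! ## §1 Coordinates of the three cone charts -/

/-- Coordinates of `e₁⁻¹(t, w)` (`e₁ = piFinSuccAbove 1`): `(w 0, t, w 1)`. [folklore] -/
theorem piFinSuccAbove_one_symm_coords (t : ℝ) (w : Fin 2 → ℝ) :
    (MeasurableEquiv.piFinSuccAbove (fun _ : Fin 3 => ℝ) 1).symm (t, w) 0 = w 0 ∧
      (MeasurableEquiv.piFinSuccAbove (fun _ : Fin 3 => ℝ) 1).symm (t, w) 1 = t ∧
      (MeasurableEquiv.piFinSuccAbove (fun _ : Fin 3 => ℝ) 1).symm (t, w) 2 = w 1 := by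
  refine ⟨?_, ?_, ?_⟩ <;> simp [MeasurableEquiv.piFinSuccAbove, Fin.insertNthEquiv] <;> rfl

/-- Coordinates of `e₂⁻¹(t, w)` (`e₂ = piFinSuccAbove 2`): `(w 0, w 1, t)`. [folklore] -/
theorem piFinSuccAbove_two_symm_coords (t : ℝ) (w : Fin 2 → ℝ) :
    (MeasurableEquiv.piFinSuccAbove (fun _ : Fin 3 => ℝ) 2).symm (t, w) 0 = w 0 ∧
      (MeasurableEquiv.piFinSuccAbove (fun _ : Fin 3 => ℝ) 2).symm (t, w) 1 = w 1 ∧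
      (MeasurableEquiv.piFinSuccAbove (fun _ : Fin 3 => ℝ) 2).symm (t, w) 2 = t := by
  refine ⟨?_, ?_, ?_⟩ <;> simp [MeasurableEquiv.piFinSuccAbove, Fin.insertNthEquiv] <;> rfl

/-- The cone-chart point `e_i⁻¹(λ⁻¹a, (λ⁻¹a)•v)`, `λ = √(1+|v|²)`: its radius² is `a²`, and its coordinates `0,1,2` are `λ⁻¹a` resp. `λ⁻¹a·v_j`
according to `i`; we only record `|x|² = a²` and the transverse sizes `x₁²+x₂²`. [folklore] -/
theorem coneChart_letters (a : ℝ) (v : Fin 2 → ℝ) :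
    (normSq3 ((MeasurableEquiv.piFinSuccAbove (fun _ : Fin 3 => ℝ) 0).symm
          ((Real.sqrt (1 + (v 0 ^ 2 + v 1 ^ 2)))⁻¹ * a, ((Real.sqrt (1 + (v 0 ^ 2 + v 1 ^ 2)))⁻¹ * a) • v)) = a ^ 2 ∧
        ((MeasurableEquiv.piFinSuccAbove (fun _ : Fin 3 => ℝ) 0).symm
            ((Real.sqrt (1 + (v 0 ^ 2 + v 1 ^ 2)))⁻¹ * a, ((Real.sqrt (1 + (v 0 ^ 2 + v 1 ^ 2)))⁻¹ * a) • v) 1) ^ 2 +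
          ((MeasurableEquiv.piFinSuccAbove (fun _ : Fin 3 => ℝ) 0).symm
            ((Real.sqrt (1 + (v 0 ^ 2 + v 1 ^ 2)))⁻¹ * a, ((Real.sqrt (1 + (v 0 ^ 2 + v 1 ^ 2)))⁻¹ * a) • v) 2) ^ 2 =
          ((Real.sqrt (1 + (v 0 ^ 2 + v 1 ^ 2)))⁻¹ * a) ^ 2 * (v 0 ^ 2 + v 1 ^ 2)) ∧
      (normSq3 ((MeasurableEquiv.piFinSuccAbove (fun _ : Fin 3 => ℝ) 1).symm
          ((Real.sqrt (1 + (v 0 ^ 2 + v 1 ^ 2)))⁻¹ * a, ((Real.sqrt (1 + (v 0 ^ 2 + v 1 ^ 2)))⁻¹ * a) • v)) = a ^ 2 ∧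
        ((MeasurableEquiv.piFinSuccAbove (fun _ : Fin 3 => ℝ) 1).symm
            ((Real.sqrt (1 + (v 0 ^ 2 + v 1 ^ 2)))⁻¹ * a, ((Real.sqrt (1 + (v 0 ^ 2 + v 1 ^ 2)))⁻¹ * a) • v) 1) ^ 2 +
          ((MeasurableEquiv.piFinSuccAbove (fun _ : Fin 3 => ℝ) 1).symm
            ((Real.sqrt (1 + (v 0 ^ 2 + v 1 ^ 2)))⁻¹ * a, ((Real.sqrt (1 + (v 0 ^ 2 + v 1 ^ 2)))⁻¹ * a) • v) 2) ^ 2 =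
          ((Real.sqrt (1 + (v 0 ^ 2 + v 1 ^ 2)))⁻¹ * a) ^ 2 * (1 + v 1 ^ 2)) ∧
      (normSq3 ((MeasurableEquiv.piFinSuccAbove (fun _ : Fin 3 => ℝ) 2).symm
          ((Real.sqrt (1 + (v 0 ^ 2 + v 1 ^ 2)))⁻¹ * a, ((Real.sqrt (1 + (v 0 ^ 2 + v 1 ^ 2)))⁻¹ * a) • v)) = a ^ 2 ∧
        ((MeasurableEquiv.piFinSuccAbove (fun _ : Fin 3 => ℝ) 2).symm
            ((Real.sqrt (1 + (v 0 ^ 2 + v 1 ^ 2)))⁻¹ * a, ((Real.sqrt (1 + (v 0 ^ 2 + v 1 ^ 2)))⁻¹ * a) • v) 1) ^ 2 +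
          ((MeasurableEquiv.piFinSuccAbove (fun _ : Fin 3 => ℝ) 2).symm
            ((Real.sqrt (1 + (v 0 ^ 2 + v 1 ^ 2)))⁻¹ * a, ((Real.sqrt (1 + (v 0 ^ 2 + v 1 ^ 2)))⁻¹ * a) • v) 2) ^ 2 =
          ((Real.sqrt (1 + (v 0 ^ 2 + v 1 ^ 2)))⁻¹ * a) ^ 2 * (v 1 ^ 2 + 1)) := by
  set t : ℝ := (Real.sqrt (1 + (v 0 ^ 2 + v 1 ^ 2)))⁻¹ * a with htdef
  have hl : 0 < 1 + (v 0 ^ 2 + v 1 ^ 2) := by positivity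
  have ht2 : t ^ 2 * (1 + (v 0 ^ 2 + v 1 ^ 2)) = a ^ 2 := by
    rw [htdef, mul_pow, inv_pow, Real.sq_sqrt hl.le]; field_simp
  obtain ⟨a0, a1, a2⟩ := piFinSuccAbove_symm_coords t (t • v)
  obtain ⟨b0, b1, b2⟩ := piFinSuccAbove_one_symm_coords t (t • v)
  obtain ⟨c0, c1, c2⟩ := piFinSuccAbove_two_symm_coords t (t • v)
  simp only [Pi.smul_apply, smul_eq_mul] at a0 a1 a2 b0 b1 b2 c0 c1 c2
  refine ⟨⟨?_, ?_⟩, ⟨?_, ?_⟩, ⟨?_, ?_⟩⟩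
  · rw [normSq3_eq_three', a0, a1, a2, ← ht2]; ring
  · rw [a1, a2]; ring
  · rw [normSq3_eq_three', b0, b1, b2, ← ht2]; ring
  · rw [b1, b2]; ring
  · rw [normSq3_eq_three', c0, c1, c2, ← ht2]; ring
  · rw [c1, c2]; ring

/-! ## §2 The angular factors -/

/-- The disc `|v|² ≤ 2` has area `≤ 8`. [folklore] -/
theorem volume_disc_two_le : volume {v : Fin 2 → ℝ | v 0 ^ 2 + v 1 ^ 2 ≤ 2} ≤ ENNReal.ofReal 8 := by
  have h := volume_disc_fin_two_le (R := Real.sqrt 2) (by positivity)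
  rw [Real.sq_sqrt (by norm_num : (0 : ℝ) ≤ 2)] at h
  refine h.trans (le_of_eq ?_)
  congr 1
  rw [mul_pow, Real.sq_sqrt (by norm_num : (0 : ℝ) ≤ 2)]; norm_num

/-- Angular factor on `K₀`: `∫⁻ 𝟙_{|v|²≤2} e^{−g|v|²∕(1+|v|²)} ≤ 3π∕g`. [folklore] -/
theorem angular_K0_le {g : ℝ} (hg : 0 < g) :
    ∫⁻ v : Fin 2 → ℝ, {v : Fin 2 → ℝ | v 0 ^ 2 + v 1 ^ 2 ≤ 2}.indicator
        (fun v => ENNReal.ofReal (Real.exp (-(g * ((v 0 ^ 2 + v 1 ^ 2) / (1 + (v 0 ^ 2 + v 1 ^ 2))))))) v ≤ ENNReal.ofReal (3 * Real.pi / g) := by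
  have h := lintegral_le_of_le_exp_neg_mul_sq (κ := g / 3) (by positivity)
    (f := fun v => {v : Fin 2 → ℝ | v 0 ^ 2 + v 1 ^ 2 ≤ 2}.indicator
      (fun v => ENNReal.ofReal (Real.exp (-(g * ((v 0 ^ 2 + v 1 ^ 2) / (1 + (v 0 ^ 2 + v 1 ^ 2))))))) v) (fun v => ?_)
  · refine h.trans (le_of_eq ?_); congr 1; field_simp
  by_cases hv : v ∈ {v : Fin 2 → ℝ | v 0 ^ 2 + v 1 ^ 2 ≤ 2}
  · rw [Set.indicator_of_mem hv]
    refine ENNReal.ofReal_le_ofReal (Real.exp_le_exp.2 (neg_le_neg ?_))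
    have hv' : v 0 ^ 2 + v 1 ^ 2 ≤ 2 := hv
    have h3 : (v 0 ^ 2 + v 1 ^ 2) / 3 ≤ (v 0 ^ 2 + v 1 ^ 2) / (1 + (v 0 ^ 2 + v 1 ^ 2)) :=
      div_le_div_of_nonneg_left (by positivity) (by positivity) (by linarith)
    calc g / 3 * (v 0 ^ 2 + v 1 ^ 2) = g * ((v 0 ^ 2 + v 1 ^ 2) / 3) := by ring
      _ ≤ g * ((v 0 ^ 2 + v 1 ^ 2) / (1 + (v 0 ^ 2 + v 1 ^ 2))) := mul_le_mul_of_nonneg_left h3 hg.le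
  · rw [Set.indicator_of_notMem hv]; exact zero_le

/-- Angular factor on `K₁, K₂`: `∫⁻ 𝟙_{|v|²≤2} e^{−g∕3} ≤ 24∕g`. [folklore] -/
theorem angular_K12_le {g : ℝ} (hg : 0 < g) :
    ∫⁻ v : Fin 2 → ℝ, {v : Fin 2 → ℝ | v 0 ^ 2 + v 1 ^ 2 ≤ 2}.indicator (fun _ => ENNReal.ofReal (Real.exp (-(g / 3)))) v ≤ ENNReal.ofReal (24 / g) := by
  have hS : MeasurableSet {v : Fin 2 → ℝ | v 0 ^ 2 + v 1 ^ 2 ≤ 2} := measurableSet_le (by fun_prop) (by fun_prop)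
  rw [lintegral_indicator hS, setLIntegral_const]
  calc ENNReal.ofReal (Real.exp (-(g / 3))) * volume {v : Fin 2 → ℝ | v 0 ^ 2 + v 1 ^ 2 ≤ 2}
      ≤ ENNReal.ofReal ((g / 3)⁻¹) * ENNReal.ofReal 8 := mul_le_mul' (ENNReal.ofReal_le_ofReal (exp_neg_le_inv (by positivity))) volume_disc_two_le
    _ = ENNReal.ofReal (24 / g) := by rw [← ENNReal.ofReal_mul (by positivity)]; congr 1; field_simp; norm_num

/-! ## §3 The axial cone integral -/

set_option maxHeartbeats 1600000 in
/-- ★★ **THE AXIAL CONE INTEGRAL OF THE ALIGNED FRAME** (see the file header). [folklore] -/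
theorem lintegral_axial_cones_le {σ β : ℝ} (hσ : 0 < σ) (hβ : 0 < β) {Ψ : ℝ → ℝ≥0∞} (hΨ : Measurable Ψ) :
    ∫⁻ x : Fin 3 → ℝ, {x : Fin 3 → ℝ | σ < normSq3 x}.indicator
        (fun x => ENNReal.ofReal (gnomonicWeight x * Real.exp (-(β * (2 * σ * (x 1 ^ 2 + x 2 ^ 2) / (1 + normSq3 x))))) * Ψ (normSq3 x)) x ≤
      ENNReal.ofReal ((3 * Real.pi + 48) / (2 * β * σ)) *
        ∫⁻ a : ℝ, {a : ℝ | σ < a ^ 2}.indicator (fun a => ENNReal.ofReal ((1 + a ^ 2)⁻¹) * Ψ (a ^ 2)) a := by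
  have hmeasN : Measurable (normSq3 : (Fin 3 → ℝ) → ℝ) := continuous_normSq3.measurable
  have hS : MeasurableSet {x : Fin 3 → ℝ | σ < normSq3 x} := measurableSet_lt measurable_const hmeasN
  set H : (Fin 3 → ℝ) → ℝ≥0∞ := fun x => {x : Fin 3 → ℝ | σ < normSq3 x}.indicator
        (fun x => ENNReal.ofReal (gnomonicWeight x * Real.exp (-(β * (2 * σ * (x 1 ^ 2 + x 2 ^ 2) / (1 + normSq3 x))))) * Ψ (normSq3 x)) x with hH
  have hw : Measurable (gnomonicWeight : (Fin 3 → ℝ) → ℝ) := by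
    unfold gnomonicWeight; exact ((measurable_const.add hmeasN).inv).pow_const 2
  have hHm : Measurable H := by
    rw [hH]
    refine Measurable.indicator (Measurable.mul (Measurable.ennreal_ofReal (hw.mul (Real.measurable_exp.comp ?_))) (hΨ.comp hmeasN)) hS
    exact ((Measurable.div (by fun_prop) (measurable_const.add hmeasN)).const_mul β).neg
  -- the radial majorant after a cone chart: `F θ (a, v) = 𝟙{σ<a²}·((1+a²)⁻¹)²·e^{−g(a²)·θ(v)}·Ψ(a²)·a²`
  set g : ℝ → ℝ := fun A => 2 * β * σ * A / (1 + A) with hg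
  have hg0 : ∀ {A : ℝ}, 0 < A → 0 < g A := fun hA => by rw [hg]; positivity
  set R : ℝ → ℝ≥0∞ := fun a => {a : ℝ | σ < a ^ 2}.indicator (fun a => ENNReal.ofReal (((1 + a ^ 2)⁻¹) ^ 2 * a ^ 2) * Ψ (a ^ 2)) a with hR
  have hRm : Measurable R := by
    rw [hR]
    exact Measurable.indicator ((Measurable.ennreal_ofReal (by fun_prop)).mul (hΨ.comp (by fun_prop))) (measurableSet_lt measurable_const (by fun_prop))
  -- the three chart integrands are bounded by `R a · angular factor`
  have hchart : ∀ (i : Fin 3) (a : ℝ) (v : Fin 2 → ℝ), v 0 ^ 2 + v 1 ^ 2 ≤ 2 →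
      H ((MeasurableEquiv.piFinSuccAbove (fun _ : Fin 3 => ℝ) i).symm
          ((Real.sqrt (1 + (v 0 ^ 2 + v 1 ^ 2)))⁻¹ * a, ((Real.sqrt (1 + (v 0 ^ 2 + v 1 ^ 2)))⁻¹ * a) • v)) *
        ENNReal.ofReal (a ^ 2 / Real.sqrt (1 + (v 0 ^ 2 + v 1 ^ 2)) ^ 3) ≤
      R a * (if i = 0 then ENNReal.ofReal (Real.exp (-(g (a ^ 2) * ((v 0 ^ 2 + v 1 ^ 2) / (1 + (v 0 ^ 2 + v 1 ^ 2))))))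
        else ENNReal.ofReal (Real.exp (-(g (a ^ 2) / 3)))) := by
    intro i a v hv
    obtain ⟨⟨n0, s0⟩, ⟨n1, s1⟩, ⟨n2, s2⟩⟩ := coneChart_letters a v
    set lam : ℝ := Real.sqrt (1 + (v 0 ^ 2 + v 1 ^ 2)) with hlam
    have hl1 : 1 ≤ 1 + (v 0 ^ 2 + v 1 ^ 2) := by nlinarith [sq_nonneg (v 0), sq_nonneg (v 1)]
    have hlam1 : 1 ≤ lam := by rw [hlam]; exact Real.one_le_sqrt.2 hl1
    have hlam0 : 0 < lam := by linarith
    have hlam2 : lam ^ 2 = 1 + (v 0 ^ 2 + v 1 ^ 2) := Real.sq_sqrt (by linarith)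
    set t : ℝ := lam⁻¹ * a with ht
    have ht2 : t ^ 2 = a ^ 2 / (1 + (v 0 ^ 2 + v 1 ^ 2)) := by rw [ht, mul_pow, inv_pow, hlam2]; field_simp
    -- Jacobian `a²/λ³ ≤ a²`
    have hjac : a ^ 2 / lam ^ 3 ≤ a ^ 2 := div_le_self (sq_nonneg a) (one_le_pow₀ hlam1)
    by_cases ha : σ < a ^ 2
    swap
    · -- outside `{σ < a²}` both sides vanish on the left
      have hzero : ∀ x : Fin 3 → ℝ, normSq3 x = a ^ 2 → H x = 0 := fun x hx => by
        rw [hH]; simp only; rw [Set.indicator_of_notMem]; simp [hx, ha]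
      have hHz : H ((MeasurableEquiv.piFinSuccAbove (fun _ : Fin 3 => ℝ) i).symm (t, t • v)) = 0 := by
        fin_cases i
        · exact hzero _ n0
        · exact hzero _ n1
        · exact hzero _ n2
      rw [hHz, zero_mul]; exact zero_le
    have ha0 : 0 < a ^ 2 := hσ.trans ha
    have hRa : R a = ENNReal.ofReal (((1 + a ^ 2)⁻¹) ^ 2 * a ^ 2) * Ψ (a ^ 2) := by
      rw [hR]; simp only; rw [Set.indicator_of_mem (by exact ha)]
    -- evaluate `H` at a chart point with `|x|² = a²` and transverse size `T`
    have hval : ∀ x : Fin 3 → ℝ, normSq3 x = a ^ 2 → ∀ θ : ℝ, θ * a ^ 2 ≤ x 1 ^ 2 + x 2 ^ 2 → 0 ≤ θ →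
        H x * ENNReal.ofReal (a ^ 2 / lam ^ 3) ≤ R a * ENNReal.ofReal (Real.exp (-(g (a ^ 2) * θ))) := by
      intro x hx θ hθ hθ0
      rw [hH, hRa]; simp only; rw [Set.indicator_of_mem (by simp [hx, ha]), hx]
      have hwx : gnomonicWeight x = ((1 + a ^ 2)⁻¹) ^ 2 := by unfold gnomonicWeight; rw [hx]
      rw [hwx]
      have hE : Real.exp (-(β * (2 * σ * (x 1 ^ 2 + x 2 ^ 2) / (1 + a ^ 2)))) ≤ Real.exp (-(g (a ^ 2) * θ)) := by
        refine Real.exp_le_exp.2 (neg_le_neg ?_)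
        rw [hg]; simp only
        have e : 2 * β * σ * a ^ 2 / (1 + a ^ 2) * θ = β * (2 * σ * (θ * a ^ 2) / (1 + a ^ 2)) := by ring
        rw [e]
        exact mul_le_mul_of_nonneg_left (div_le_div_of_nonneg_right (mul_le_mul_of_nonneg_left hθ (by positivity)) (by positivity)) hβ.le
      have key : ((1 + a ^ 2)⁻¹) ^ 2 * Real.exp (-(β * (2 * σ * (x 1 ^ 2 + x 2 ^ 2) / (1 + a ^ 2)))) * (a ^ 2 / lam ^ 3) ≤
          ((1 + a ^ 2)⁻¹) ^ 2 * a ^ 2 * Real.exp (-(g (a ^ 2) * θ)) := by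
        calc ((1 + a ^ 2)⁻¹) ^ 2 * Real.exp (-(β * (2 * σ * (x 1 ^ 2 + x 2 ^ 2) / (1 + a ^ 2)))) * (a ^ 2 / lam ^ 3)
            ≤ ((1 + a ^ 2)⁻¹) ^ 2 * Real.exp (-(g (a ^ 2) * θ)) * a ^ 2 :=
              mul_le_mul (mul_le_mul_of_nonneg_left hE (by positivity)) hjac (by positivity) (by positivity)
          _ = ((1 + a ^ 2)⁻¹) ^ 2 * a ^ 2 * Real.exp (-(g (a ^ 2) * θ)) := by ring
      calc ENNReal.ofReal (((1 + a ^ 2)⁻¹) ^ 2 * Real.exp (-(β * (2 * σ * (x 1 ^ 2 + x 2 ^ 2) / (1 + a ^ 2))))) * Ψ (a ^ 2) * ENNReal.ofReal (a ^ 2 / lam ^ 3)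
          = Ψ (a ^ 2) * ENNReal.ofReal (((1 + a ^ 2)⁻¹) ^ 2 * Real.exp (-(β * (2 * σ * (x 1 ^ 2 + x 2 ^ 2) / (1 + a ^ 2)))) * (a ^ 2 / lam ^ 3)) := by
            rw [ENNReal.ofReal_mul (p := ((1 + a ^ 2)⁻¹) ^ 2 * Real.exp (-(β * (2 * σ * (x 1 ^ 2 + x 2 ^ 2) / (1 + a ^ 2))))) (by positivity)]
            ring
        _ ≤ Ψ (a ^ 2) * ENNReal.ofReal (((1 + a ^ 2)⁻¹) ^ 2 * a ^ 2 * Real.exp (-(g (a ^ 2) * θ))) := mul_le_mul' le_rfl (ENNReal.ofReal_le_ofReal key)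
        _ = ENNReal.ofReal (((1 + a ^ 2)⁻¹) ^ 2 * a ^ 2) * Ψ (a ^ 2) * ENNReal.ofReal (Real.exp (-(g (a ^ 2) * θ))) := by
            rw [ENNReal.ofReal_mul (p := ((1 + a ^ 2)⁻¹) ^ 2 * a ^ 2) (by positivity)]
            ring
    fin_cases i
    · -- K₀: `T = t²|v|² = a²·|v|²/(1+|v|²)`
      simp only [Fin.zero_eta, Fin.isValue, ↓reduceIte]
      refine hval _ n0 _ (le_of_eq ?_) (by positivity)
      rw [s0, ht2]; ring
    · simp only [Fin.mk_one, Fin.isValue, one_ne_zero, ↓reduceIte]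
      have h := hval _ n1 (1 / 3) ?_ (by norm_num)
      · refine h.trans (le_of_eq ?_); rw [show g (a ^ 2) * (1 / 3) = g (a ^ 2) / 3 by ring]
      · rw [s1, ht2]
        have hv0 : v 0 ^ 2 ≤ 2 := by nlinarith [sq_nonneg (v 1)]
        have key : 1 / 3 ≤ (1 + v 1 ^ 2) / (1 + (v 0 ^ 2 + v 1 ^ 2)) := by
          rw [div_le_div_iff₀ (by norm_num) (by positivity)]; nlinarith [sq_nonneg (v 1)]
        calc 1 / 3 * a ^ 2 ≤ (1 + v 1 ^ 2) / (1 + (v 0 ^ 2 + v 1 ^ 2)) * a ^ 2 := mul_le_mul_of_nonneg_right key (sq_nonneg a)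
          _ = a ^ 2 / (1 + (v 0 ^ 2 + v 1 ^ 2)) * (1 + v 1 ^ 2) := by ring
    · simp only [Fin.reduceFinMk, Fin.isValue, Fin.reduceEq, ↓reduceIte]
      have h := hval _ n2 (1 / 3) ?_ (by norm_num)
      · refine h.trans (le_of_eq ?_); rw [show g (a ^ 2) * (1 / 3) = g (a ^ 2) / 3 by ring]
      · rw [s2, ht2]
        have hv0 : v 0 ^ 2 ≤ 2 := by nlinarith [sq_nonneg (v 1)]
        have key : 1 / 3 ≤ (v 1 ^ 2 + 1) / (1 + (v 0 ^ 2 + v 1 ^ 2)) := by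
          rw [div_le_div_iff₀ (by norm_num) (by positivity)]; nlinarith [sq_nonneg (v 1)]
        calc 1 / 3 * a ^ 2 ≤ (v 1 ^ 2 + 1) / (1 + (v 0 ^ 2 + v 1 ^ 2)) * a ^ 2 := mul_le_mul_of_nonneg_right key (sq_nonneg a)
          _ = a ^ 2 / (1 + (v 0 ^ 2 + v 1 ^ 2)) * (v 1 ^ 2 + 1) := by ring
  -- angular integrals per chart, at fixed radius
  have hang : ∀ (i : Fin 3) (a : ℝ),
      R a * ∫⁻ v : Fin 2 → ℝ, {v : Fin 2 → ℝ | v 0 ^ 2 + v 1 ^ 2 ≤ 2}.indicator (fun v =>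
        (if i = 0 then ENNReal.ofReal (Real.exp (-(g (a ^ 2) * ((v 0 ^ 2 + v 1 ^ 2) / (1 + (v 0 ^ 2 + v 1 ^ 2))))))
          else ENNReal.ofReal (Real.exp (-(g (a ^ 2) / 3))))) v ≤
      R a * ENNReal.ofReal ((if i = 0 then 3 * Real.pi else 24) / g (a ^ 2)) := by
    intro i a
    by_cases ha : σ < a ^ 2
    swap
    · have hR0 : R a = 0 := by rw [hR]; simp only; rw [Set.indicator_of_notMem (by exact ha)]
      rw [hR0, zero_mul, zero_mul]
    have hga : 0 < g (a ^ 2) := hg0 (hσ.trans ha)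
    refine mul_le_mul' le_rfl ?_
    fin_cases i
    · simp only [Fin.zero_eta, Fin.isValue, ↓reduceIte]; exact angular_K0_le hga
    · simp only [Fin.mk_one, Fin.isValue, one_ne_zero, ↓reduceIte]; exact angular_K12_le hga
    · simp only [Fin.reduceFinMk, Fin.isValue, Fin.reduceEq, ↓reduceIte]; exact angular_K12_le hga
  -- each cone chart integral is bounded by `∫⁻ a, R a · C_i / g(a²)`
  have hK : MeasurableSet {q : ℝ × (Fin 2 → ℝ) | q.2 0 ^ 2 + q.2 1 ^ 2 ≤ 2 * q.1 ^ 2} :=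
    measurableSet_le (by fun_prop) (by fun_prop)
  have hD : MeasurableSet {v : Fin 2 → ℝ | v 0 ^ 2 + v 1 ^ 2 ≤ 2} := measurableSet_le (by fun_prop) (by fun_prop)
  have hgm : Measurable fun a : ℝ => g (a ^ 2) := by rw [hg]; fun_prop
  have hΘm : ∀ i : Fin 3, Measurable fun q : (Fin 2 → ℝ) × ℝ =>
      {v : Fin 2 → ℝ | v 0 ^ 2 + v 1 ^ 2 ≤ 2}.indicator (fun v =>
        (if i = 0 then ENNReal.ofReal (Real.exp (-(g (q.2 ^ 2) * ((v 0 ^ 2 + v 1 ^ 2) / (1 + (v 0 ^ 2 + v 1 ^ 2))))))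
          else ENNReal.ofReal (Real.exp (-(g (q.2 ^ 2) / 3))))) q.1 := by
    intro i
    have e : (fun q : (Fin 2 → ℝ) × ℝ => {v : Fin 2 → ℝ | v 0 ^ 2 + v 1 ^ 2 ≤ 2}.indicator (fun v =>
        (if i = 0 then ENNReal.ofReal (Real.exp (-(g (q.2 ^ 2) * ((v 0 ^ 2 + v 1 ^ 2) / (1 + (v 0 ^ 2 + v 1 ^ 2))))))
          else ENNReal.ofReal (Real.exp (-(g (q.2 ^ 2) / 3))))) q.1) =
        ({q : (Fin 2 → ℝ) × ℝ | q.1 0 ^ 2 + q.1 1 ^ 2 ≤ 2}).indicator (fun q =>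
          (if i = 0 then ENNReal.ofReal (Real.exp (-(g (q.2 ^ 2) * ((q.1 0 ^ 2 + q.1 1 ^ 2) / (1 + (q.1 0 ^ 2 + q.1 1 ^ 2))))))
            else ENNReal.ofReal (Real.exp (-(g (q.2 ^ 2) / 3))))) := by
      funext q
      by_cases hq : q.1 ∈ {v : Fin 2 → ℝ | v 0 ^ 2 + v 1 ^ 2 ≤ 2}
      · rw [Set.indicator_of_mem hq, Set.indicator_of_mem (by exact hq)]
      · rw [Set.indicator_of_notMem hq, Set.indicator_of_notMem (by exact hq)]
    rw [e]
    refine Measurable.indicator ?_ (measurableSet_le (by fun_prop) (by fun_prop))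
    split_ifs
    · refine Measurable.ennreal_ofReal (Real.measurable_exp.comp ?_)
      exact ((hgm.comp measurable_snd).mul (by fun_prop)).neg
    · exact Measurable.ennreal_ofReal (Real.measurable_exp.comp ((hgm.comp measurable_snd).div_const 3).neg)
  have hcone : ∀ i : Fin 3,
      ∫⁻ q : ℝ × (Fin 2 → ℝ), {q : ℝ × (Fin 2 → ℝ) | q.2 0 ^ 2 + q.2 1 ^ 2 ≤ 2 * q.1 ^ 2}.indicator
          (fun q => H ((MeasurableEquiv.piFinSuccAbove (fun _ : Fin 3 => ℝ) i).symm q)) q ≤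
        ∫⁻ a : ℝ, R a * ENNReal.ofReal ((if i = 0 then 3 * Real.pi else 24) / g (a ^ 2)) := by
    intro i
    set e := MeasurableEquiv.piFinSuccAbove (fun _ : Fin 3 => ℝ) i with he
    have hHe : Measurable fun q : ℝ × (Fin 2 → ℝ) => H (e.symm q) := hHm.comp e.symm.measurable
    rw [lintegral_cone_subst hHe]
    set Θ : ℝ → (Fin 2 → ℝ) → ℝ≥0∞ := fun a v =>
      (if i = 0 then ENNReal.ofReal (Real.exp (-(g (a ^ 2) * ((v 0 ^ 2 + v 1 ^ 2) / (1 + (v 0 ^ 2 + v 1 ^ 2))))))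
        else ENNReal.ofReal (Real.exp (-(g (a ^ 2) / 3)))) with hΘ
    calc ∫⁻ v : Fin 2 → ℝ, {v : Fin 2 → ℝ | v 0 ^ 2 + v 1 ^ 2 ≤ 2}.indicator (fun v => ∫⁻ a : ℝ,
            H (e.symm ((Real.sqrt (1 + (v 0 ^ 2 + v 1 ^ 2)))⁻¹ * a, ((Real.sqrt (1 + (v 0 ^ 2 + v 1 ^ 2)))⁻¹ * a) • v)) *
              ENNReal.ofReal (a ^ 2 / Real.sqrt (1 + (v 0 ^ 2 + v 1 ^ 2)) ^ 3)) v
        ≤ ∫⁻ v : Fin 2 → ℝ, ∫⁻ a : ℝ, {v : Fin 2 → ℝ | v 0 ^ 2 + v 1 ^ 2 ≤ 2}.indicator (fun v => R a * Θ a v) v := by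
          refine lintegral_mono fun v => ?_
          by_cases hv : v ∈ {v : Fin 2 → ℝ | v 0 ^ 2 + v 1 ^ 2 ≤ 2}
          · rw [Set.indicator_of_mem hv]
            refine lintegral_mono fun a => ?_
            rw [Set.indicator_of_mem hv]
            exact hchart i a v hv
          · rw [Set.indicator_of_notMem hv]; exact zero_le
      _ = ∫⁻ a : ℝ, ∫⁻ v : Fin 2 → ℝ, {v : Fin 2 → ℝ | v 0 ^ 2 + v 1 ^ 2 ≤ 2}.indicator (fun v => R a * Θ a v) v := by
          refine lintegral_lintegral_swap ?_
          have hm : Measurable fun q : (Fin 2 → ℝ) × ℝ => {v : Fin 2 → ℝ | v 0 ^ 2 + v 1 ^ 2 ≤ 2}.indicator (fun v => R q.2 * Θ q.2 v) q.1 := by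
            have e2 : (fun q : (Fin 2 → ℝ) × ℝ => {v : Fin 2 → ℝ | v 0 ^ 2 + v 1 ^ 2 ≤ 2}.indicator (fun v => R q.2 * Θ q.2 v) q.1) =
                fun q => R q.2 * {v : Fin 2 → ℝ | v 0 ^ 2 + v 1 ^ 2 ≤ 2}.indicator (fun v => Θ q.2 v) q.1 := by
              funext q
              by_cases hq : q.1 ∈ {v : Fin 2 → ℝ | v 0 ^ 2 + v 1 ^ 2 ≤ 2}
              · rw [Set.indicator_of_mem hq, Set.indicator_of_mem hq]
              · rw [Set.indicator_of_notMem hq, Set.indicator_of_notMem hq, mul_zero]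
            rw [e2]
            exact (hRm.comp measurable_snd).mul (by simpa [hΘ] using hΘm i)
          exact hm.aemeasurable
      _ = ∫⁻ a : ℝ, R a * ∫⁻ v : Fin 2 → ℝ, {v : Fin 2 → ℝ | v 0 ^ 2 + v 1 ^ 2 ≤ 2}.indicator (fun v => Θ a v) v := by
          refine lintegral_congr fun a => ?_
          have e3 : (fun v : Fin 2 → ℝ => {v : Fin 2 → ℝ | v 0 ^ 2 + v 1 ^ 2 ≤ 2}.indicator (fun v => R a * Θ a v) v) =
              fun v => R a * {v : Fin 2 → ℝ | v 0 ^ 2 + v 1 ^ 2 ≤ 2}.indicator (fun v => Θ a v) v := by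
            funext v
            by_cases hv : v ∈ {v : Fin 2 → ℝ | v 0 ^ 2 + v 1 ^ 2 ≤ 2}
            · rw [Set.indicator_of_mem hv, Set.indicator_of_mem hv]
            · rw [Set.indicator_of_notMem hv, Set.indicator_of_notMem hv, mul_zero]
          rw [e3]
          exact lintegral_const_mul _ ((hΘm i).comp (measurable_id.prodMk measurable_const))
      _ ≤ ∫⁻ a : ℝ, R a * ENNReal.ofReal ((if i = 0 then 3 * Real.pi else 24) / g (a ^ 2)) :=
          lintegral_mono fun a => by simpa [hΘ] using hang i a
  -- assemble the three charts
  have hsum : ∀ a : ℝ, R a * ENNReal.ofReal (3 * Real.pi / g (a ^ 2)) + R a * ENNReal.ofReal (24 / g (a ^ 2)) + R a * ENNReal.ofReal (24 / g (a ^ 2)) =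
      ENNReal.ofReal ((3 * Real.pi + 48) / (2 * β * σ)) * {a : ℝ | σ < a ^ 2}.indicator (fun a => ENNReal.ofReal ((1 + a ^ 2)⁻¹) * Ψ (a ^ 2)) a := by
    intro a
    by_cases ha : σ < a ^ 2
    · have ha0 : 0 < a ^ 2 := hσ.trans ha
      have hga : 0 < g (a ^ 2) := hg0 ha0
      rw [hR]; simp only; rw [Set.indicator_of_mem (by exact ha), Set.indicator_of_mem (by exact ha)]
      have hform : ∀ Z : ℝ, 0 ≤ Z → ENNReal.ofReal (((1 + a ^ 2)⁻¹) ^ 2 * a ^ 2) * Ψ (a ^ 2) * ENNReal.ofReal Z =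
          Ψ (a ^ 2) * ENNReal.ofReal (((1 + a ^ 2)⁻¹) ^ 2 * a ^ 2 * Z) := fun Z hZ => by
        rw [ENNReal.ofReal_mul (p := ((1 + a ^ 2)⁻¹) ^ 2 * a ^ 2) (by positivity)]; ring
      rw [hform _ (by positivity), hform _ (by positivity), ← mul_add, ← mul_add, ← ENNReal.ofReal_add (by positivity) (by positivity),
        ← ENNReal.ofReal_add (by positivity) (by positivity)]
      rw [show ENNReal.ofReal ((3 * Real.pi + 48) / (2 * β * σ)) * (ENNReal.ofReal ((1 + a ^ 2)⁻¹) * Ψ (a ^ 2)) =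
          Ψ (a ^ 2) * ENNReal.ofReal ((3 * Real.pi + 48) / (2 * β * σ) * (1 + a ^ 2)⁻¹) by
        rw [ENNReal.ofReal_mul (p := (3 * Real.pi + 48) / (2 * β * σ)) (by positivity)]; ring]
      have hane : a ≠ 0 := by intro h; rw [h] at ha0; simp at ha0
      congr 2
      rw [hg]; simp only; field_simp; ring
    · rw [hR]; simp only; rw [Set.indicator_of_notMem (by exact ha), Set.indicator_of_notMem (by exact ha)]; simp
  have hR3 : Measurable fun a : ℝ => R a * ENNReal.ofReal (3 * Real.pi / g (a ^ 2)) := hRm.mul (Measurable.ennreal_ofReal (measurable_const.div hgm))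
  have hR24 : Measurable fun a : ℝ => R a * ENNReal.ofReal (24 / g (a ^ 2)) := hRm.mul (Measurable.ennreal_ofReal (measurable_const.div hgm))
  have hR324 : Measurable fun a : ℝ => R a * ENNReal.ofReal (3 * Real.pi / g (a ^ 2)) + R a * ENNReal.ofReal (24 / g (a ^ 2)) := hR3.add hR24
  calc ∫⁻ x, H x ≤ _ := lintegral_le_cones_transfer hHm
    _ ≤ (∫⁻ a : ℝ, R a * ENNReal.ofReal (3 * Real.pi / g (a ^ 2))) + (∫⁻ a : ℝ, R a * ENNReal.ofReal (24 / g (a ^ 2))) +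
          (∫⁻ a : ℝ, R a * ENNReal.ofReal (24 / g (a ^ 2))) := by
        refine add_le_add (add_le_add ?_ ?_) ?_
        · simpa using hcone 0
        · simpa using hcone 1
        · simpa using hcone 2
    _ = ∫⁻ a : ℝ, (R a * ENNReal.ofReal (3 * Real.pi / g (a ^ 2)) + R a * ENNReal.ofReal (24 / g (a ^ 2)) + R a * ENNReal.ofReal (24 / g (a ^ 2))) := by
        rw [← lintegral_add_left hR3, ← lintegral_add_left hR324]
    _ = ∫⁻ a : ℝ, ENNReal.ofReal ((3 * Real.pi + 48) / (2 * β * σ)) * {a : ℝ | σ < a ^ 2}.indicator (fun a => ENNReal.ofReal ((1 + a ^ 2)⁻¹) * Ψ (a ^ 2)) a :=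
        lintegral_congr hsum
    _ = ENNReal.ofReal ((3 * Real.pi + 48) / (2 * β * σ)) * ∫⁻ a : ℝ, {a : ℝ | σ < a ^ 2}.indicator (fun a => ENNReal.ofReal ((1 + a ^ 2)⁻¹) * Ψ (a ^ 2)) a :=
        lintegral_const_mul' _ _ ENNReal.ofReal_ne_top

end Summit.QuantumFields.YangMills.Theorems.SwapVirialDeficit.SectorLaplace

end
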